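import Summits.HodgeConjecture.HodgeConjecture.Theorems.Ring2WeilCoverageProductWindow
import Summits.HodgeConjecture.HodgeConjecture.Theorems.Ring2WeilNormObstructionDescentCensus
import HarnessLib

/-!
# Weil-type family coverage — THEOREM S7 (carrier-free product-window law), part I: `ℚ(√-7)` through the degree-3 carriers `F₂₁` and
# `PSL₂(7)` — the row `W6.7.5 = (3, ℚ(√-7), [5])` (×2 of ring2-b06's moving family, and a rigid `F₂₁ × S₅` member of genus 781) and the
# eightfold row `W8.7.5 = (4, ℚ(√-7), [5])` (rigid `F₂₁ × A₅` curves of genus 349)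

research route conditional on HC_CM; not a corollary; Q11.4-sentence-2 already refuted in dim ≥ 3.

Ring 2, WEIL-TYPE FAMILY-COVERAGE CENSUS (`HOME/WEIL-FAMILY-COVERAGE.md` `## b04`, block b04.14 P.S., owner ring2-b04, gen 50); ninth part
of `Ring2WeilCoverageProductWindow` (imports part A).  THEOREM S7 (census b04.14 (A)): for a carrier `(G₁, λ, H₁)` with `S_in(G₁,λ) = ∅`
and any 2-transitive `G₂` of degree `n`, a WEIL-TYPE hidden factor has `[a_B] = [n]^{r₁}`.  Here `K = ℚ(√-7)`, `n = 5` (`5` inert in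
`ℚ(√-7)`), carriers `F₂₁ = C₇ ⋊ C₃` (degree 3, `H₁ = C₃`; odd order ⟹ `S_in = ∅`) and `PSL₂(7)` (degree 3, `H₁ = C₃`; `3` inert of
defect zero, `2` split ⟹ `S_in = ∅`); all four data have `r₁` odd, so S7 predicts the class `[5]`, `T = {5,7}` — found 4/4:
* ring2-b06's ONE-PARAMETER `PSL₂(7) × A₅` family `(0; 2:22, 2:22, 2:22, 7a:3)` of genus 2281 (census b06.21, 2026-08-23T16:32Z: moving and
  Hodge-generic by their unipotent Lie closure; their `det_K H = -2¹⁹·5³·7²`, `T = {5,7}`) — recomputed on THIS seat's coset engine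
  (`cosetwin.py`, coset cover `C̃/(C₃ × A₄)`: 280 sheets, genus 59; 2158 s, exact): `det H = -13133/6272000 = -(23·571)/(2¹⁰·5³·7²)`,
  `T = {5,7}`, `r₁ = 3` — CONCUR (independent model of `PSL₂(7)`, independent cover construction, independent cohomology code);
* the RIGID `F₂₁ × S₅`-curve `(0; 3a:32, 3b:32, 7a:3)` of genus 781 (`S₅`-signature `(6,6,3)`; coset cover of genus 7, 35 sheets): a `(3,3)`
  Weil-type sixfold with `det H = -128/5`, `T = {5,7}` — the smallest curve-carried member of `W6.7.5` I know of (a Belyi point; CM not claimed);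
* the RIGID `F₂₁ × A₅`-curves `(0; 3a:3, 3b:5A, 7a:3)`, `(0; 3a:5A, 3b:3, 7a:3)` of genus 349 (`A₅`-signature `(3,5,3)`): `(4,4)` Weil-type
  EIGHTFOLDS with `det H = 256/5`, `512/5`, `T = {5,7}`: row `W8.7.5` (for the census's `g = 8` `ℚ(√-7)` table).
The arithmetic skeleton is part H §1 (`carrierWindow_mk_eq_mk_pow`, free carrier constant); this part holds the literal classes with their
CELL IDENTIFICATIONS `[det H] = [-5]` / `[5]` only.  Engine and outputs: mirror `pub-hodge-ring2-b04/census-g50/`.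

No `def`, no named fact, no `sorry`; nothing here is a statement about Hodge classes; `HC_CM` is used nowhere.
References: [cite: vanGeemen1994HodgeAV, (5.4.1), Lemma 5.2].
-/

set_option linter.dupNamespace false

open Literature.AlgebraicGeometry.Motives
open Literature.AlgebraicGeometry.VanGeemen1994
open Summit.HodgeConjecture.HodgeConjecture.Ring2.Hypotheses

namespace Summit.HodgeConjecture.HodgeConjecture.Ring2.WeilCoverage

/-- `PSL₂(7) × A₅` (`PSL₂(7)` as the degree-3 carrier of `ℚ(√-7)`, `H₁ = C₃`; `A₅` on 5 points)-cover `(0; 2:22,2:22,2:22,7a:3)` (genus 2281, Hurwitz dimension 1; engine `cosetwin.py` on the coset cover `C̃/(H₁ × Stab(0))`, 280 sheets, genus 59, its own polarisation, exact): the HIDDEN FACTOR `B = V^{H₁×Stab(0)}` of the `(λ⊗ρ)`-piece `P` — an abelian SIXFOLD with `(3,3)` `ℚ(√-7)`-action, WEIL TYPE — has literal `det H|_B = -13133/6272000`, `a = 13133/6272000`, `T(a) = [5, 7]`: row `W6.7.5` (NON-split); `r₁ = dim_K H¹(C̃/G₂)_λ = 3`.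
research route conditional on HC_CM; not a corollary; Q11.4-sentence-2 already refuted in dim ≥ 3. [cite: vanGeemen1994HodgeAV, (5.4.1)] -/
theorem pwL27cA5_222_222_222_7a3_q0_g2281_mk_detH_ne_split :
    (QuotientGroup.mk (Units.mk0 (((-13133 : ℚ) / 6272000)) (by norm_num)) : weilNormResidueGroup 7) ≠
      splitDiscriminantClass 3 7 := by
  have e : Units.mk0 (((-13133 : ℚ) / 6272000)) (by norm_num) = -(Units.mk0 ((13133 : ℚ) / 6272000) (by norm_num)) := Units.ext (by norm_num)
  rw [Ne, e, mk_neg_eq_splitDiscriminantClass_iff_of_odd (n := 3) (by decide)]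
  have h := mul_not_mem_normUnitsSubgroup (mem_normUnitsSubgroup_of_sq_add_mul_sq (d := 7) (a := ((13133 : ℚ) / 31360000)) (by norm_num) ((-11 : ℚ) / 1120) ((19 : ℚ) / 2800) (by norm_num))
    Summit.HodgeConjecture.Ring2WeilNormDescent.five_not_mem_norm_seven
  rw [mk0_mul_mk0] at h
  norm_num at h
  exact h

/-- The same datum, CELL IDENTIFICATION: `[det H|_B] = [-5]` in `ℚˣ/Nm(ℚ(√-7)ˣ)` — the census ROW KEY of `W6.7.5` (`a·5 = ((13133 : ℚ) / 1254400) = (((-11 : ℚ) / 224))² + 7·(((19 : ℚ) / 560))²`).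
research route conditional on HC_CM; not a corollary; Q11.4-sentence-2 already refuted in dim ≥ 3. [cite: vanGeemen1994HodgeAV, Lemma 5.2 (3)] -/
theorem pwL27cA5_222_222_222_7a3_q0_g2281_mk_detH_eq_key :
    (QuotientGroup.mk (Units.mk0 (-(((13133 : ℚ) / 6272000))) (neg_ne_zero.2 (by norm_num))) : weilNormResidueGroup 7) =
      QuotientGroup.mk (Units.mk0 (-(5 : ℚ)) (neg_ne_zero.2 (by norm_num))) :=
  mk_neg_eq_mk_neg_of_mul_mem (by norm_num) (by norm_num)
    (mem_normUnitsSubgroup_of_sq_add_mul_sq _ ((-11 : ℚ) / 224) ((19 : ℚ) / 560) (by norm_num))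

/-- `F₂₁ × S₅` (`F₂₁ = C₇ ⋊ C₃` the degree-3 carrier of `ℚ(√-7)`, `H₁ = C₃`; `S₅` on 5 points)-cover `(0; 3a:32,3b:32,7a:3)` (genus 781, Hurwitz dimension 0; engine `cosetwin.py` on the coset cover `C̃/(H₁ × Stab(0))`, 35 sheets, genus 7, its own polarisation, exact): the HIDDEN FACTOR `B = V^{H₁×Stab(0)}` of the `(λ⊗ρ)`-piece `P` — an abelian SIXFOLD with `(3,3)` `ℚ(√-7)`-action, WEIL TYPE — has literal `det H|_B = -128/5`, `a = 128/5`, `T(a) = [5, 7]`: row `W6.7.5` (NON-split); `r₁ = dim_K H¹(C̃/G₂)_λ = 1`. THEOREM S7 (carrier-free product-window law, census b04.14 (A)) predicts `T(a_B) = [5, 7]` from `r₁ = 1` (`[a_B] = [n]^{r₁}`, `n = 5`) — CONFIRMED.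
research route conditional on HC_CM; not a corollary; Q11.4-sentence-2 already refuted in dim ≥ 3. [cite: vanGeemen1994HodgeAV, (5.4.1)] -/
theorem pwF21S5_3a32_3b32_7a3_q0_g781_mk_detH_ne_split :
    (QuotientGroup.mk (Units.mk0 (((-128 : ℚ) / 5)) (by norm_num)) : weilNormResidueGroup 7) ≠
      splitDiscriminantClass 3 7 := by
  have e : Units.mk0 (((-128 : ℚ) / 5)) (by norm_num) = -(Units.mk0 ((128 : ℚ) / 5) (by norm_num)) := Units.ext (by norm_num)
  rw [Ne, e, mk_neg_eq_splitDiscriminantClass_iff_of_odd (n := 3) (by decide)]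
  have h := mul_not_mem_normUnitsSubgroup (mem_normUnitsSubgroup_of_sq_add_mul_sq (d := 7) (a := ((128 : ℚ) / 25)) (by norm_num) ((4 : ℚ) / 5) ((4 : ℚ) / 5) (by norm_num))
    Summit.HodgeConjecture.Ring2WeilNormDescent.five_not_mem_norm_seven
  rw [mk0_mul_mk0] at h
  norm_num at h
  exact h

/-- The same datum, CELL IDENTIFICATION: `[det H|_B] = [-5]` in `ℚˣ/Nm(ℚ(√-7)ˣ)` — the census ROW KEY of `W6.7.5` (`a·5 = (128 : ℚ) = ((4 : ℚ))² + 7·((4 : ℚ))²`).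
research route conditional on HC_CM; not a corollary; Q11.4-sentence-2 already refuted in dim ≥ 3. [cite: vanGeemen1994HodgeAV, Lemma 5.2 (3)] -/
theorem pwF21S5_3a32_3b32_7a3_q0_g781_mk_detH_eq_key :
    (QuotientGroup.mk (Units.mk0 (-(((128 : ℚ) / 5))) (neg_ne_zero.2 (by norm_num))) : weilNormResidueGroup 7) =
      QuotientGroup.mk (Units.mk0 (-(5 : ℚ)) (neg_ne_zero.2 (by norm_num))) :=
  mk_neg_eq_mk_neg_of_mul_mem (by norm_num) (by norm_num)
    (mem_normUnitsSubgroup_of_sq_add_mul_sq _ (4 : ℚ) (4 : ℚ) (by norm_num))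

/-- `F₂₁ × A₅` (`F₂₁` the degree-3 carrier of `ℚ(√-7)`; `A₅` on 5 points)-cover `(0; 3a:3,3b:5A,7a:3)` (genus 349, Hurwitz dimension 0; engine `cosetwin.py` on the coset cover `C̃/(H₁ × Stab(0))`, 35 sheets, genus 9, its own polarisation, exact): the HIDDEN FACTOR `B = V^{H₁×Stab(0)}` of the `(λ⊗ρ)`-piece `P` — an abelian EIGHTFOLD with `(4,4)` `ℚ(√-7)`-action, WEIL TYPE — has literal `det H|_B = 256/5`, `a = 256/5`, `T(a) = [5, 7]`: row `W8.7.5` (NON-split); `r₁ = dim_K H¹(C̃/G₂)_λ = 1`. THEOREM S7 (carrier-free product-window law, census b04.14 (A)) predicts `T(a_B) = [5, 7]` from `r₁ = 1` (`[a_B] = [n]^{r₁}`, `n = 5`) — CONFIRMED.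
research route conditional on HC_CM; not a corollary; Q11.4-sentence-2 already refuted in dim ≥ 3. [cite: vanGeemen1994HodgeAV, (5.4.1)] -/
theorem pwF21A5_3a3_3b5A_7a3_q0_g349_mk_detH_ne_split :
    (QuotientGroup.mk (Units.mk0 (((256 : ℚ) / 5)) (by norm_num)) : weilNormResidueGroup 7) ≠
      splitDiscriminantClass 4 7 := by
  have e : Units.mk0 (((256 : ℚ) / 5)) (by norm_num) = Units.mk0 ((256 : ℚ) / 5) (by norm_num) := Units.ext (by norm_num)
  rw [Ne, e, mk_eq_splitDiscriminantClass_iff_of_even (n := 4) (by decide)]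
  have h := mul_not_mem_normUnitsSubgroup (mem_normUnitsSubgroup_of_sq_add_mul_sq (d := 7) (a := ((256 : ℚ) / 25)) (by norm_num) ((16 : ℚ) / 5) (0 : ℚ) (by norm_num))
    Summit.HodgeConjecture.Ring2WeilNormDescent.five_not_mem_norm_seven
  rw [mk0_mul_mk0] at h
  norm_num at h
  exact h

/-- The same datum, CELL IDENTIFICATION: `[det H|_B] = [5]` in `ℚˣ/Nm(ℚ(√-7)ˣ)` — the census ROW KEY of `W8.7.5` (`a·5 = (256 : ℚ) = ((16 : ℚ))² + 7·((0 : ℚ))²`).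
research route conditional on HC_CM; not a corollary; Q11.4-sentence-2 already refuted in dim ≥ 3. [cite: vanGeemen1994HodgeAV, Lemma 5.2 (3)] -/
theorem pwF21A5_3a3_3b5A_7a3_q0_g349_mk_detH_eq_key :
    (QuotientGroup.mk (Units.mk0 (((256 : ℚ) / 5)) (by norm_num)) : weilNormResidueGroup 7) =
      QuotientGroup.mk (Units.mk0 (5 : ℚ) (by norm_num)) :=
  mk_eq_mk_of_mul_mem (by norm_num) (by norm_num)
    (mem_normUnitsSubgroup_of_sq_add_mul_sq _ (16 : ℚ) (0 : ℚ) (by norm_num))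

/-- `F₂₁ × A₅` (`F₂₁` the degree-3 carrier of `ℚ(√-7)`; `A₅` on 5 points)-cover `(0; 3a:5A,3b:3,7a:3)` (genus 349, Hurwitz dimension 0; engine `cosetwin.py` on the coset cover `C̃/(H₁ × Stab(0))`, 35 sheets, genus 9, its own polarisation, exact): the HIDDEN FACTOR `B = V^{H₁×Stab(0)}` of the `(λ⊗ρ)`-piece `P` — an abelian EIGHTFOLD with `(4,4)` `ℚ(√-7)`-action, WEIL TYPE — has literal `det H|_B = 512/5`, `a = 512/5`, `T(a) = [5, 7]`: row `W8.7.5` (NON-split); `r₁ = dim_K H¹(C̃/G₂)_λ = 1`. THEOREM S7 (carrier-free product-window law, census b04.14 (A)) predicts `T(a_B) = [5, 7]` from `r₁ = 1` (`[a_B] = [n]^{r₁}`, `n = 5`) — CONFIRMED.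
research route conditional on HC_CM; not a corollary; Q11.4-sentence-2 already refuted in dim ≥ 3. [cite: vanGeemen1994HodgeAV, (5.4.1)] -/
theorem pwF21A5_3a5A_3b3_7a3_q0_g349_mk_detH_ne_split :
    (QuotientGroup.mk (Units.mk0 (((512 : ℚ) / 5)) (by norm_num)) : weilNormResidueGroup 7) ≠
      splitDiscriminantClass 4 7 := by
  have e : Units.mk0 (((512 : ℚ) / 5)) (by norm_num) = Units.mk0 ((512 : ℚ) / 5) (by norm_num) := Units.ext (by norm_num)
  rw [Ne, e, mk_eq_splitDiscriminantClass_iff_of_even (n := 4) (by decide)]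
  have h := mul_not_mem_normUnitsSubgroup (mem_normUnitsSubgroup_of_sq_add_mul_sq (d := 7) (a := ((512 : ℚ) / 25)) (by norm_num) ((8 : ℚ) / 5) ((8 : ℚ) / 5) (by norm_num))
    Summit.HodgeConjecture.Ring2WeilNormDescent.five_not_mem_norm_seven
  rw [mk0_mul_mk0] at h
  norm_num at h
  exact h

/-- The same datum, CELL IDENTIFICATION: `[det H|_B] = [5]` in `ℚˣ/Nm(ℚ(√-7)ˣ)` — the census ROW KEY of `W8.7.5` (`a·5 = (512 : ℚ) = ((8 : ℚ))² + 7·((8 : ℚ))²`).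
research route conditional on HC_CM; not a corollary; Q11.4-sentence-2 already refuted in dim ≥ 3. [cite: vanGeemen1994HodgeAV, Lemma 5.2 (3)] -/
theorem pwF21A5_3a5A_3b3_7a3_q0_g349_mk_detH_eq_key :
    (QuotientGroup.mk (Units.mk0 (((512 : ℚ) / 5)) (by norm_num)) : weilNormResidueGroup 7) =
      QuotientGroup.mk (Units.mk0 (5 : ℚ) (by norm_num)) :=
  mk_eq_mk_of_mul_mem (by norm_num) (by norm_num)
    (mem_normUnitsSubgroup_of_sq_add_mul_sq _ (8 : ℚ) (8 : ℚ) (by norm_num))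

end Summit.HodgeConjecture.HodgeConjecture.Ring2.WeilCoverage
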